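import Literature.AnabelianGeometry.EtaleTheta.SettingModelKrullMuTwoInversion
import Literature.AnabelianGeometry.EtaleTheta.SettingModelKummerDataEmpty
import HarnessLib

/-!
# The untwisted Krull models carry NO Kummer data: `IsEmpty (modelκ′ p).KummerData` — so every
# `EtaleThetaData`-indexed structure (`DoubleUnderline`, `OrbitEmbedding`, theta environments …) is VACUOUS there

S. Mochizuki, *The étale theta function and its Frobenioid-theoretic manifestations*, Publ. RIMS **45** (2009) [EtTh],
§1 p. 12 («`Δ^Θ_X` … a central extension», «`Δ_Θ ≅ Ẑ(1)`»), Prop. 1.5 p. 23 («`F² = H¹(G_K, Δ_Θ) ⥲ H¹(G_K, Ẑ(1)) ⥲ (K^×)^∧`»)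
[cite: MochizukiEtTh2009, Prop 1.5 p.23]. Cell abc-iut, layer L2, seat abc-iut-L2-t10 (gen 6), Krull row — the kernel SIZING
of the κ′ twins of R312 / R319 (abc-iut-L2-lead ROWS #18/#22: «OrbitEmbedding κ′ twin after the χ shape», «R319 after K6»).

PROOF-ONLY file (no `def`, no instance, no new `Prop`). The outer chain of [EtTh] Cor. 2.8 (iii) (abc-iut-w6-d051 /
w5-d118 lineages) is stated over `ε : C.OrbitEmbedding T` for `C : E.DoubleUnderline l`, `E : D.EtaleThetaData` — and
`EtaleThetaData` EXTENDS abc-iut-L2-t1's `KummerData` (the injections `K^× ↪ (K^×)^∧ ↪ H¹((Π^tp_Y)^Θ, Δ_Θ)`). abc-iut-w5-d171's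
criterion `ThetaSetting.isEmpty_kummerData_of_conj_eq` (`SettingModelKummerDataEmpty`, p424679): if `(Π^tp_Y)^Θ` CENTRALISES
`Δ_Θ` and `K^×` has an element `u ≠ 1` with `u² = 1`, there is no Kummer datum (`H¹` has no `2`-torsion). At the untwisted
Krull models `ThetaSetting.modelκ p` / `modelκ′ p` (K2/K3b; `Π^tp_X = Γ ⋊_{θ∘1} G_{ℚ_p}` with `G_{ℚ_p}` acting TRIVIALLY on
`Γ`, `actκ_apply_eq`) the WHOLE `(Π^tp_X)^Θ` centralises `Δ_Θ`: the Galois factor commutes with `Γ` on the nose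
(`inr_mul_inl_κ`), the geometric factor by the root field `ker_thetaToEll_central`. Hence:
* `toTheta_conj_eq_of_mem_deltaTheta_modelκ'` / `…_modelκ`;
* **`ThetaSetting.modelκ'_isEmpty_kummerData`**, **`modelκ'_isEmpty_etaleThetaData`** (and the `modelκ` twins);
* **`MuTwoSetting.inversionModelκ'_isEmpty_etaleThetaData`** — over K5b's `MuTwoSetting.inversionModelκ′` there is NO
  `EtaleThetaData`, so NO `DoubleUnderline`, NO `OrbitEmbedding`, no `StandardData`: the κ′ twins of R312 (OrbitEmbedding NV)
  and of R319 (outer-transport (A)(B)(C) at κ′) are NOT INSTANTIABLE AS TYPED — the commutator-axis-cusp carrier of record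
  (the only model with hIx) cannot carry Kummer data while UNTWISTED; a carrier with hIx ∧ Kummer data needs the TWISTED
  action (abc-iut-L2-t5 g6's modelκ^χ, R291). What κ′ DOES witness is in K6 (`Discharge/Sec2OuterTransportModelKrull`):
  `MuTwoSetting` + `CLevelData` + `TemperedCoverData` with every binder and the outer automorphism pair for every `g ∈ Π^tp_C`.
(Private bookkeeping: `−1 ≠ 1` in `K^×`, characteristic `0`.)
HONEST LIMITS: statements about the cell's SEMI-SYNTHETIC models only; in [EtTh] `G_K` acts on `Δ_Θ ≅ Ẑ(1)` through the
cyclotomic character and `(K^×)^∧` does carry `μ(K)`; nothing of [EtTh] is asserted or denied; no side is taken on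
[IUTchIII] Cor. 3.12; typed ≠ proved.
-/

noncomputable section

namespace Literature.AnabelianGeometry.EtaleTheta

open Literature.AnabelianGeometry.SemiGraphs

/-! ### Generic: `−1 ≠ 1` in `K^×` -/

namespace ThetaSetting

variable {p : ℕ} [Fact p.Prime] (D : ThetaSetting p)

/-- `−1 ≠ 1` in `K^×` for the base field `K ⊆ ℚ̄_p` of any theta setting (characteristic `0`; private bookkeeping, as in
abc-iut-w5-d171's root-model file). [folklore] -/
private theorem neg_one_ne_one_unitsK : (-1 : (↥D.K)ˣ) ≠ 1 := by
  intro h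
  have h1 : ((-1 : (↥D.K)ˣ) : ↥D.K) = 1 := by rw [h, Units.val_one]
  rw [Units.val_neg, Units.val_one] at h1
  have h2 : (D.K.val) (-1) = (D.K.val) 1 := by rw [h1]
  rw [map_neg, map_one] at h2
  haveI : CharZero (PadicAlgCl p) :=
    charZero_of_injective_algebraMap (algebraMap ℚ_[p] (PadicAlgCl p)).injective
  have h3 : (2 : PadicAlgCl p) = 0 := by linear_combination -h2
  exact two_ne_zero h3

end ThetaSetting

namespace SettingModel

variable (p : ℕ) [Fact p.Prime]

/-! ### The Galois factor of `Π^tp_X = Γ ⋊_{θ∘1} G_{ℚ_p}` commutes with `Γ` -/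

/-- **`inr σ · inl γ = inl γ · inr σ`** in `Π^tp_X = Γ ⋊_{θ∘1} G_{ℚ_p}`: the action `actκ` is TRIVIAL (`actκ_apply_eq`), so the
semidirect product is a direct product in all but name. [cite: MochizukiEtTh2009, §1 p.12] -/
theorem inr_mul_inl_κ (σ : GQp p) (γ : Gfp) :
    (SemidirectProduct.inr σ : PiTpκ p) * SemidirectProduct.inl γ = SemidirectProduct.inl γ * SemidirectProduct.inr σ := by
  refine SemidirectProduct.ext ?_ ?_
  · rw [SemidirectProduct.mul_left, SemidirectProduct.mul_left, SemidirectProduct.left_inr, SemidirectProduct.right_inr,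
      SemidirectProduct.left_inl, SemidirectProduct.right_inl, actκ_apply_eq, actκ_apply_eq, one_mul, mul_one]
  · rw [SemidirectProduct.mul_right, SemidirectProduct.mul_right, SemidirectProduct.right_inr, SemidirectProduct.right_inl,
      one_mul, mul_one]

/-- A lift to `Π^tp_X` of an element of `Δ_Θ` has trivial Galois component (`Δ_Θ ⊆ (Δ^tp_X)^Θ`, `Ker ⊆ Δ^tp_X`).
[cite: MochizukiEtTh2009, §1 p.12] -/
theorem right_eq_one_of_mk_mem_deltaTheta_modelκ' {y : PiTpκ p}
    (hy : (ThetaSetting.modelκ' p).toTheta y ∈ (ThetaSetting.modelκ' p).DeltaTheta) : y.right = 1 :=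
  (mem_deltaTempκ_iff p y).mp
    (CurveTheta.ellKer_le_deltaTemp (curveκ' p) ((CurveTheta.mk_mem_ker_thetaToEll_iff (curveκ' p) y).mp hy))

/-- **At `modelκ′` the whole `(Π^tp_X)^Θ` centralises `Δ_Θ`**: for `x = inl γ · inr σ`, `inr σ` commutes with the lift
`inl γ'` of `a ∈ Δ_Θ` on the nose (trivial action) and `inl γ ∈ Δ^tp_X` commutes with `a` modulo `Ker(↠ Θ)` by the root field
`ker_thetaToEll_central` («`Δ^Θ_X` is a central extension», p. 12). [cite: MochizukiEtTh2009, §1 p.12] -/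
theorem toTheta_conj_eq_of_mem_deltaTheta_modelκ' (g a : (ThetaSetting.modelκ' p).GtpTheta)
    (ha : a ∈ (ThetaSetting.modelκ' p).DeltaTheta) : g * a * g⁻¹ = a := by
  suffices h : g * a = a * g by rw [h, mul_inv_cancel_right]
  obtain ⟨x, rfl⟩ := QuotientGroup.mk_surjective g
  obtain ⟨y, rfl⟩ := QuotientGroup.mk_surjective a
  have hy1 : y.right = 1 := right_eq_one_of_mk_mem_deltaTheta_modelκ' p ha
  have hyeq : y = SemidirectProduct.inl y.left := by
    rw [← SemidirectProduct.inl_left_mul_inr_right y, hy1, map_one, mul_one, SemidirectProduct.left_inl]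
  -- the Galois factor commutes with `y` in `Π^tp_X`
  have hR : (SemidirectProduct.inr x.right : PiTpκ p) * y = y * SemidirectProduct.inr x.right := by
    rw [hyeq, inr_mul_inl_κ]
  -- the geometric factor commutes with `a` in `(Π^tp_X)^Θ` (centrality of `Δ_Θ`)
  have hL : ((SemidirectProduct.inl x.left : PiTpκ p) : (ThetaSetting.modelκ' p).GtpTheta) *
      (y : (ThetaSetting.modelκ' p).GtpTheta) = (y : (ThetaSetting.modelκ' p).GtpTheta) *
      ((SemidirectProduct.inl x.left : PiTpκ p) : (ThetaSetting.modelκ' p).GtpTheta) :=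
    ((ThetaSetting.modelκ' p).ker_thetaToEll_central _ ha _ ⟨SemidirectProduct.inl x.left, inl_mem_deltaTempκ p x.left,
      rfl⟩).symm
  have hx : x = SemidirectProduct.inl x.left * SemidirectProduct.inr x.right :=
    (SemidirectProduct.inl_left_mul_inr_right x).symm
  calc ((x : PiTpκ p) : (ThetaSetting.modelκ' p).GtpTheta) * (y : (ThetaSetting.modelκ' p).GtpTheta)
      = ((SemidirectProduct.inl x.left : PiTpκ p) : (ThetaSetting.modelκ' p).GtpTheta) *
          (((SemidirectProduct.inr x.right : PiTpκ p) * y : PiTpκ p) : (ThetaSetting.modelκ' p).GtpTheta) := by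
        conv_lhs => rw [hx]
        rw [QuotientGroup.mk_mul, QuotientGroup.mk_mul, mul_assoc]
    _ = (y : (ThetaSetting.modelκ' p).GtpTheta) *
          (((SemidirectProduct.inl x.left : PiTpκ p) * SemidirectProduct.inr x.right : PiTpκ p) :
            (ThetaSetting.modelκ' p).GtpTheta) := by
        rw [hR, QuotientGroup.mk_mul, ← mul_assoc, hL, mul_assoc, QuotientGroup.mk_mul]
    _ = (y : (ThetaSetting.modelκ' p).GtpTheta) * ((x : PiTpκ p) : (ThetaSetting.modelκ' p).GtpTheta) := by
        rw [← hx]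

/-- The same at K2's cuspless `modelκ` (identical `Π^tp_X`, identical theta quotient). [cite: MochizukiEtTh2009, §1 p.12] -/
theorem toTheta_conj_eq_of_mem_deltaTheta_modelκ (g a : (ThetaSetting.modelκ p).GtpTheta)
    (ha : a ∈ (ThetaSetting.modelκ p).DeltaTheta) : g * a * g⁻¹ = a :=
  toTheta_conj_eq_of_mem_deltaTheta_modelκ' p g a ha

/-! ### No Kummer data, no étale theta data at the untwisted Krull models -/

/-- **`modelκ′` carries NO Kummer data**: `−1 ∈ ℚ_p^× = K^×` would inject through `toKHat ≫ kumY` to a `2`-torsion class of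
`H¹((Π^tp_Y)^Θ, Δ_Θ)`, which has none since `(Π^tp_X)^Θ` centralises `Δ_Θ` (abc-iut-w5-d171's criterion
`isEmpty_kummerData_of_conj_eq` under the guard `modelκ'_isEtThOrigin`). [cite: MochizukiEtTh2009, Prop 1.5 p.23] -/
theorem _root_.Literature.AnabelianGeometry.EtaleTheta.ThetaSetting.modelκ'_isEmpty_kummerData :
    IsEmpty (ThetaSetting.modelκ' p).KummerData :=
  (ThetaSetting.modelκ' p).isEmpty_kummerData_of_conj_eq (ThetaSetting.modelκ'_isEtThOrigin p)
    (fun g _ a ha => toTheta_conj_eq_of_mem_deltaTheta_modelκ' p g a ha) (-1)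
    ((ThetaSetting.modelκ' p).neg_one_ne_one_unitsK) neg_one_sq

/-- Hence **no étale theta data over `modelκ′`** (`EtaleThetaData` extends `KummerData`).
[cite: MochizukiEtTh2009, Prop 1.3 p.20] -/
theorem _root_.Literature.AnabelianGeometry.EtaleTheta.ThetaSetting.modelκ'_isEmpty_etaleThetaData :
    IsEmpty (ThetaSetting.modelκ' p).EtaleThetaData :=
  ⟨fun E => (ThetaSetting.modelκ'_isEmpty_kummerData p).false E.toKummerData⟩

/-- `modelκ` (K2, cuspless) carries no Kummer data either. [cite: MochizukiEtTh2009, Prop 1.5 p.23] -/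
theorem _root_.Literature.AnabelianGeometry.EtaleTheta.ThetaSetting.modelκ_isEmpty_kummerData :
    IsEmpty (ThetaSetting.modelκ p).KummerData :=
  (ThetaSetting.modelκ p).isEmpty_kummerData_of_conj_eq (ThetaSetting.modelκ_isEtThOrigin p)
    (fun g _ a ha => toTheta_conj_eq_of_mem_deltaTheta_modelκ p g a ha) (-1)
    ((ThetaSetting.modelκ p).neg_one_ne_one_unitsK) neg_one_sq

/-- … and no étale theta data. [cite: MochizukiEtTh2009, Prop 1.3 p.20] -/
theorem _root_.Literature.AnabelianGeometry.EtaleTheta.ThetaSetting.modelκ_isEmpty_etaleThetaData :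
    IsEmpty (ThetaSetting.modelκ p).EtaleThetaData :=
  ⟨fun E => (ThetaSetting.modelκ_isEmpty_kummerData p).false E.toKummerData⟩

/-- **Over K5b's `MuTwoSetting.inversionModelκ′` there is NO `EtaleThetaData`** (its theta setting IS `modelκ′`): every
structure indexed by an `E : EtaleThetaData` of that model — `E.DoubleUnderline l`, `C.OrbitEmbedding T`, `StandardData`,
`ThetaEnvData` built from `E` — is uninstantiable there; the κ′ twins of the OrbitEmbedding NV (R312) and of the outer
transport (A)(B)(C) (R319) are NOT INSTANTIABLE AS TYPED. [cite: MochizukiEtTh2009, Prop 1.3 p.20] -/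
theorem _root_.Literature.AnabelianGeometry.EtaleTheta.MuTwoSetting.inversionModelκ'_isEmpty_etaleThetaData :
    IsEmpty (MuTwoSetting.inversionModelκ' p).toThetaSetting.EtaleThetaData :=
  ThetaSetting.modelκ'_isEmpty_etaleThetaData p

/-- In particular no `DoubleUnderline` over `inversionModelκ′` (census form: the Σ-type is empty).
[cite: MochizukiEtTh2009, Def 2.5 p.39] -/
theorem _root_.Literature.AnabelianGeometry.EtaleTheta.MuTwoSetting.inversionModelκ'_isEmpty_doubleUnderline (l : ℕ) :
    IsEmpty (Σ E : (MuTwoSetting.inversionModelκ' p).toThetaSetting.EtaleThetaData, E.DoubleUnderline l) :=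
  ⟨fun ⟨E, _⟩ => (MuTwoSetting.inversionModelκ'_isEmpty_etaleThetaData p).false E⟩

/-- CENSUS TOKEN (Krull row): at the untwisted commutator-axis-cusp model the `MuTwoSetting` / `CLevelData` / cover layer is
inhabited (K5b `nonempty_cLevelData_inversionModelκ'`) while the Kummer layer is EMPTY — both facts side by side.
[cite: MochizukiEtTh2009, Prop 1.5 p.23] -/
theorem nonempty_cLevelData_and_isEmpty_kummerData_inversionModelκ' :
    Nonempty (MuTwoSetting.inversionModelκ' p).CLevelData ∧ IsEmpty (MuTwoSetting.inversionModelκ' p).toThetaSetting.KummerData :=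
  ⟨nonempty_cLevelData_inversionModelκ' p, ThetaSetting.modelκ'_isEmpty_kummerData p⟩

end SettingModel

end Literature.AnabelianGeometry.EtaleTheta

end
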